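import Literature.AlgebraicGeometry.AbelianSchemes.AbelianSchemeOverZariskiGluingPolarizationClauses
import HarnessLib

/-!
# Gluing TRIPLES `(A, λ, φ)` of [MumfordFogartyKirwan1994, Def. 7.2] along a Zariski gluing datum

Layer `Literature/AlgebraicGeometry/AbelianSchemes`, namespace
`Literature.AlgebraicGeometry.AbelianSchemes.AbelianSchemeOver.ZariskiGluingDatum.PolarizationDatum`.  Cell
`hodgecm-mathlib` (D-0151), (h7) «Zariski gluing of `S`-objects from a cocycle», the ASSEMBLY (P3) of the chain
FILE 3b (`ZariskiGluingDatum.abelianScheme`, `isOfRelDim_abelianScheme`) → FILE 4 (`levelStructure`) → (P1)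
(`PolarizationDatum.polarization`) → (P2) (`hasType_polarization`, `isSymplecticLiftable_levelStructure`);
count-neutral Literature capital.  HC_CM is proved only modulo the 7 printed citations until rung 0 closes.

Given a Zariski gluing datum `𝔇` of abelian schemes over `S` (charts `Aᵢ/Uᵢ`, glued `Z = 𝔇.abelianScheme`), a dual
pair `D₀ = (Ẑ, 𝒫₀)` OF THE GLUED SCHEME (road (D-F3): from [MumfordFogartyKirwan1994, Ch. 6 §1 Cor. 6.8], given),
chartwise polarisation data `𝔓 : PolarizationDatum 𝔇 D₀` (dual pairs `Dᵢ`, polarisations `λᵢ`, cartesian charts of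
duals `Ĝᵢ : Âᵢ → Ẑ` with Poincaré clauses, overlap agreement), chartwise level structures `ℓ : LevelDatum` agreeing on
overlaps, and the three chartwise PROPERTIES (relative dimension `g`, type `δ`, symplectic-liftability):

* **`glueTriple`** — the glued triple `(Z, λ, φ) : PolarizedAbelianSchemeWithLevel g N δ S` (all seven fields of
  the tree's structure: `A`, `relDim`, `D`, `pol`, `hasType`, `level`, `symplectic`).
* **`chartTriple i`** — the chart triple `(Aᵢ, λᵢ, φᵢ)` over `Uᵢ`, and **`isBaseChangeVia_chartTriple`**: it IS the
  pull-back of `glueTriple` along `Uᵢ → S` via `(χᵢ, Ĝᵢ)` in the sense of the moduli relation ★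
  `PolarizedAbelianSchemeWithLevel.IsBaseChangeVia` ([MumfordFogartyKirwan1994, Def. 7.2] «in the obvious way»): the
  level clause (FILE 4), the hat clause (`hĜ`), the Poincaré clause, the `λ`-clause ((P1)).

## References
* [MumfordFogartyKirwan1994] D. Mumford, J. Fogarty, F. Kirwan, *Geometric Invariant Theory* (3rd ed., 1994), Ch. 7 §2
  Definition 7.2 (p. 129); App. 7A (pp. 234–235).
* [GortzWedhorn2020] U. Görtz, T. Wedhorn, *Algebraic Geometry I* (2nd ed., 2020), Section (3.3) Proposition 3.5;
  Section (4.15) (p. 116).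
-/

noncomputable section

universe u

open CategoryTheory CategoryTheory.Limits AlgebraicGeometry MonoidalCategory

namespace Literature.AlgebraicGeometry.AbelianSchemes

namespace AbelianSchemeOver

namespace ZariskiGluingDatum

namespace PolarizationDatum

open Literature.AlgebraicGeometry.ModuliOfAbelianVarieties (IsPolarizationType)

variable {S : Scheme.{u}} {𝔇 : ZariskiGluingDatum S} {D₀ : 𝔇.abelianScheme.DualPair} (𝔓 : PolarizationDatum 𝔇 D₀)
  {g N : ℕ} {δ : Fin g → ℕ} (ℓ : 𝔇.LevelDatum g N) (hrel : ∀ i, (𝔇.A i).IsOfRelDim g)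
  (hδ : IsPolarizationType δ) (hT : ∀ i, (𝔓.pol i).HasType δ)
  (hsym : ∀ i, (ℓ.φ i).IsSymplecticLiftable (𝔓.pol i) δ)
  -- (edition 2, repair road R2⁺: the hat-normalisations of the given dual pair `D₀` and of the chart dual pairs)
  (unit₀ : Nonempty ((Scheme.Modules.pullback (DualPair.unitHatSlice D₀)).obj D₀.P ≅ SheafOfModules.unit _))
  (unit : ∀ i, Nonempty ((Scheme.Modules.pullback (DualPair.unitHatSlice (𝔓.Dc i))).obj (𝔓.Dc i).P ≅
    SheafOfModules.unit _))

/-- **The glued triple `(Z, λ, φ)` of [MumfordFogartyKirwan1994, Def. 7.2] over `S`**: the glued abelian scheme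
(FILE 3b) of relative dimension `g` (smoothness of relative dimension `g` is local on the target), the given dual
pair `D₀`, the glued polarisation ((P1)) of type `δ` ((P2)), the glued level structure (FILE 4), symplectic-liftable
((P2)). [cite: MumfordFogartyKirwan1994, Ch. 7 §2 Definition 7.2 (p. 129)] [cite: MumfordFogartyKirwan1994, App. 7A (pp. 234–235)] -/
def glueTriple : PolarizedAbelianSchemeWithLevel g N δ S where
  A := 𝔇.abelianScheme
  relDim := 𝔇.isOfRelDim_abelianScheme hrel
  D := D₀
  pol := 𝔓.polarization
  hasType := 𝔓.hasType_polarization hδ hT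
  level := 𝔇.levelStructure ℓ
  symplectic := 𝔓.isSymplecticLiftable_levelStructure ℓ hsym
  hatNormalised := unit₀

/-- The abelian scheme of the glued triple is the glued abelian scheme (definitional). [cite: MumfordFogartyKirwan1994, Ch. 7 §2 Definition 7.2 (p. 129)] -/
theorem glueTriple_A : (𝔓.glueTriple ℓ hrel hδ hT hsym unit₀).A = 𝔇.abelianScheme := rfl

/-- The dual pair of the glued triple is the given `D₀` (definitional). [cite: MumfordFogartyKirwan1994, Ch. 7 §2 Definition 7.2 (p. 129)] -/
theorem glueTriple_D : (𝔓.glueTriple ℓ hrel hδ hT hsym unit₀).D = D₀ := rfl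

/-- The polarisation of the glued triple is the glued polarisation (definitional). [cite: MumfordFogartyKirwan1994, Ch. 7 §2 Definition 7.2 (p. 129)] -/
theorem glueTriple_pol : (𝔓.glueTriple ℓ hrel hδ hT hsym unit₀).pol = 𝔓.polarization := rfl

/-- The level structure of the glued triple is the glued level structure (definitional). [cite: MumfordFogartyKirwan1994, Ch. 7 §2 Definition 7.2 (p. 129)] -/
theorem glueTriple_level : (𝔓.glueTriple ℓ hrel hδ hT hsym unit₀).level = 𝔇.levelStructure ℓ := rfl

/-- **The chart triple `(Aᵢ, λᵢ, φᵢ)` over `Uᵢ`.** [cite: MumfordFogartyKirwan1994, Ch. 7 §2 Definition 7.2 (p. 129)] -/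
def chartTriple (i : 𝔇.𝒰.I₀) : PolarizedAbelianSchemeWithLevel g N δ (𝔇.𝒰.X i) where
  A := 𝔇.A i
  relDim := hrel i
  D := 𝔓.Dc i
  pol := 𝔓.pol i
  hasType := hT i
  level := ℓ.φ i
  symplectic := hsym i
  hatNormalised := unit i

/-- The abelian scheme of the chart triple (definitional). [cite: MumfordFogartyKirwan1994, Ch. 7 §2 Definition 7.2 (p. 129)] -/
theorem chartTriple_A (i : 𝔇.𝒰.I₀) : (𝔓.chartTriple ℓ hrel hT hsym unit i).A = 𝔇.A i := rfl

/-- **Each chart triple IS the pull-back of the glued triple along `Uᵢ → S`** via `(χᵢ, Ĝᵢ)`, in the sense of the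
moduli relation ★ `PolarizedAbelianSchemeWithLevel.IsBaseChangeVia` (all five clauses: level structure — FILE 4
`isBaseChangeVia_levelStructure`; duals — `hĜ`; Poincaré — `poincare`; `λ` — (P1) `pol_lam_left_comp_Ĝ`).  This is
the «cartesian charts» property that makes the glued triple represent the glued moduli point.
[cite: MumfordFogartyKirwan1994, Ch. 7 §2 Definition 7.2 (p. 129)] [cite: GortzWedhorn2020, Section (4.15) (p. 116)] -/
theorem isBaseChangeVia_chartTriple (i : 𝔇.𝒰.I₀) :
    (𝔓.chartTriple ℓ hrel hT hsym unit i).IsBaseChangeVia (𝔓.glueTriple ℓ hrel hδ hT hsym unit₀) (𝔇.𝒰.f i) (𝔇.χ i)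
      (𝔓.Ĝ i) :=
  ⟨𝔇.isBaseChangeVia_levelStructure ℓ i, 𝔓.hĜ i, 𝔓.poincare i, 𝔓.pol_lam_left_comp_Ĝ i⟩

/-- **Uniqueness of the glued `λ` among triples with these charts**: a polarisation `λ'` of `Z` w.r.t. `D₀` whose
chart clauses are those of the `λᵢ` IS the glued one ((P1) `eq_glueLam`). [cite: GortzWedhorn2020, Section (3.3) Proposition 3.5] -/
theorem pol_lam_eq_of_chart (pol' : 𝔇.abelianScheme.Polarization D₀)
    (h : ∀ i, (𝔓.pol i).lam.left ≫ 𝔓.Ĝ i = 𝔇.χ i ≫ pol'.lam.left) :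
    pol'.lam = (𝔓.glueTriple ℓ hrel hδ hT hsym unit₀).pol.lam :=
  𝔓.eq_glueLam pol'.lam fun i => (h i).symm

end PolarizationDatum

end ZariskiGluingDatum

end AbelianSchemeOver

end Literature.AlgebraicGeometry.AbelianSchemes

end
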